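import Mathlib.AlgebraicGeometry.Restrict
import Mathlib.Topology.NoetherianSpace
import Mathlib.Topology.Sober
import Mathlib.Data.Fintype.Card
import HarnessLib

/-!
# Maximal points of a closed bad locus: finiteness, and the count drop under a super-strongly confined step
(crux `FInjectiveMacaulayfication`, hole #3 tooling)

[OURS · L1 W4.5a] Support file for crux stmt-ResolutionOfSingularities-15315
(`Summit.ResolutionOfSingularities.ResolutionOfSingularities.Theses.FrobeniusLadder.FInjectiveMacaulayfication`, route
`FrobeniusLadder`, skeleton v11 `86e9127b5c98b8e6`), hole #3 = registered stub `stub_genericFInjectivization`.  Topological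
bookkeeping for the TERMINATION half of hole #3 (consumed by `…GenericFInjectivizationOfSuperStrongStep`): the measure is the number of
GENERIZATION-MAXIMAL points of the bad locus.

* §1 `finite_setOf_maximal_of_isClosed` — in a Noetherian, quasi-sober, `T₀` space the generization-maximal points of a CLOSED set `B`
  (points `ξ ∈ B` such that `y ∈ B`, `y ⤳ ξ` forces `y = ξ`) form a finite set: `ξ ↦ closure {ξ}` injects them into the irreducible
  components of the Noetherian space `B`.
* §2 Morphisms that are isomorphisms over an open `U` (`IsIso (π ∣_ U)`): `specializes_iff_of_isIso_morphismRestrict` (for points over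
  `U`, `x ⤳ x'` iff `π x ⤳ π x'`), `eq_of_base_eq_of_isIso_morphismRestrict` (injectivity over `U`), `exists_base_eq_of_isIso_morphismRestrict`
  (surjectivity onto `U`) — through the homeomorphism `π⁻¹U ≅ U` (`Scheme.homeoOfIso`, `morphismRestrict_base_coe`).
* §4 (appended) `card_maximal_nonclosed_lt_of_strongPlusStep` — the same for STRONG⁺ steps (no NON-CLOSED bad point over
  `closure {η}`; closed ones allowed), counting only non-closed maximal bad points (CRUX-PLAN hole-#3 interfaces v3, R3′).
* §3 `card_maximal_lt_of_superStrongStep` — THE COUNT DROP: for predicates `Bad₁` on `X₁`, `Bad₂` on `X₂`, a point `η` and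
  `π : X₂ ⟶ X₁` an isomorphism over `(closure {η})ᶜ` such that `Bad₂ x ↔ Bad₁ (π x)` over that open and NO point over `closure {η}` is
  `Bad₂`: if `η` is a generization-maximal `Bad₁`-point and those are finitely many, then `X₂` has strictly fewer generization-maximal
  `Bad₂`-points than `X₁` has `Bad₁`-points (`x ↦ π x` injects the former into the latter and misses `η`).

Folklore topology; no definition is declared; AI-written, weaker than expert review; no statement of [claim: Hironaka2017] is used.
-/

-- single-problem summit: the doubled namespace component `ResolutionOfSingularities` is forced
set_option linter.dupNamespace false

noncomputable section

open CategoryTheory AlgebraicGeometry TopologicalSpace Topology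

namespace Summit.ResolutionOfSingularities.ResolutionOfSingularities.Theorems.FInjectiveMacaulayfication.BadMaximalPoints

universe v

/-! ## §1 Generization-maximal points of a closed set are finitely many -/

/-- **Finiteness of generization-maximal points.** In a Noetherian, quasi-sober `T₀` space `X`, for a closed set `B` the set of points
`ξ ∈ B` admitting no proper generization inside `B` is finite: the closures `closure {ξ}` (taken in `B`) are irreducible components of the
Noetherian space `B` (maximality: a larger closed irreducible subset of `B` has a generic point, which generizes `ξ` inside `B`), pairwise
distinct by `T₀`. [folklore] -/
theorem finite_setOf_maximal_of_isClosed {X : Type v} [TopologicalSpace X] [NoetherianSpace X] [QuasiSober X] [T0Space X]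
    {B : Set X} (hB : IsClosed B) :
    {ξ : X | ξ ∈ B ∧ ∀ y ∈ B, y ⤳ ξ → y = ξ}.Finite := by
  haveI : QuasiSober B := hB.isClosedEmbedding_subtypeVal.quasiSober
  -- the candidate component attached to a maximal point
  let Φ : {ξ : X // ξ ∈ B ∧ ∀ y ∈ B, y ⤳ ξ → y = ξ} → Set B := fun ξ => closure ({⟨ξ.1, ξ.2.1⟩} : Set B)
  have hΦmem : ∀ ξ, Φ ξ ∈ irreducibleComponents B := by
    intro ξ
    rw [irreducibleComponents_eq_maximals_closed]
    refine ⟨⟨isClosed_closure, isIrreducible_singleton.closure⟩, ?_⟩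
    rintro t ⟨htc, hti⟩ hst
    -- `t` closed irreducible in `B` containing `closure {ξ}`: its generic point generizes `ξ` inside `B`, hence equals `ξ`
    have hgen := hti.isGenericPoint_genericPoint htc
    have hξt : (⟨ξ.1, ξ.2.1⟩ : B) ∈ t := hst (subset_closure (Set.mem_singleton _))
    have hsp : hti.genericPoint ⤳ (⟨ξ.1, ξ.2.1⟩ : B) := hgen.specializes hξt
    have heq : (hti.genericPoint : X) = ξ.1 :=
      ξ.2.2 _ hti.genericPoint.2 ((subtype_specializes_iff hti.genericPoint (⟨ξ.1, ξ.2.1⟩ : B)).mp hsp)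
    have hpt : hti.genericPoint = ⟨ξ.1, ξ.2.1⟩ := Subtype.ext heq
    intro b hb
    rw [← hgen.def, hpt] at hb
    exact hb
  have hΦinj : Function.Injective Φ := by
    intro ξ ξ' h
    apply Subtype.ext
    have hmem : (⟨ξ.1, ξ.2.1⟩ : B) ∈ Φ ξ' := by
      rw [← h]; exact subset_closure (Set.mem_singleton _)
    have hsp : (⟨ξ'.1, ξ'.2.1⟩ : B) ⤳ ⟨ξ.1, ξ.2.1⟩ := specializes_iff_mem_closure.mpr hmem
    exact (ξ.2.2 _ ξ'.2.1 ((subtype_specializes_iff (⟨ξ'.1, ξ'.2.1⟩ : B) (⟨ξ.1, ξ.2.1⟩ : B)).mp hsp)).symm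
  have hfin : (irreducibleComponents B).Finite := NoetherianSpace.finite_irreducibleComponents
  haveI : Finite (irreducibleComponents B) := hfin.to_subtype
  have : Finite {ξ : X // ξ ∈ B ∧ ∀ y ∈ B, y ⤳ ξ → y = ξ} :=
    Finite.of_injective (fun ξ => (⟨Φ ξ, hΦmem ξ⟩ : irreducibleComponents B))
      (fun ξ ξ' h => hΦinj (congrArg Subtype.val h))
  exact Set.finite_coe_iff.mp this

/-! ## §2 Points over the iso-locus of a morphism -/

section IsoOver

variable {X₂ X₁ : Scheme.{0}} (π : X₂ ⟶ X₁) (U : X₁.Opens) [IsIso (π ∣_ U)]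

/-- Over the iso-locus, `π` reflects and preserves specialization: for `x, x'` over `U`, `x ⤳ x'` iff `π x ⤳ π x'` (the homeomorphism
`π⁻¹U ≅ U`, and specialization in an open subspace is specialization in the ambient space). [folklore] -/
theorem specializes_iff_of_isIso_morphismRestrict (x x' : X₂) (hx : π.base x ∈ U) (hx' : π.base x' ∈ U) :
    x ⤳ x' ↔ π.base x ⤳ π.base x' := by
  have hxU : x ∈ π ⁻¹ᵁ U := hx
  have hxU' : x' ∈ π ⁻¹ᵁ U := hx'
  let e := Scheme.homeoOfIso (asIso (π ∣_ U))
  have he : ∀ (z : X₂) (hz : z ∈ π ⁻¹ᵁ U), (e ⟨z, hz⟩).1 = π.base z := fun z hz => by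
    change ((asIso (π ∣_ U)).hom.base ⟨z, hz⟩).1 = π.base z
    rw [asIso_hom]
    exact morphismRestrict_base_coe π U ⟨z, hz⟩
  have h1 : x ⤳ x' ↔ (⟨x, hxU⟩ : ↥(π ⁻¹ᵁ U)) ⤳ ⟨x', hxU'⟩ :=
    (subtype_specializes_iff (⟨x, hxU⟩ : ↥(π ⁻¹ᵁ U)) ⟨x', hxU'⟩).symm
  have h2 : (⟨x, hxU⟩ : ↥(π ⁻¹ᵁ U)) ⤳ ⟨x', hxU'⟩ ↔ e ⟨x, hxU⟩ ⤳ e ⟨x', hxU'⟩ :=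
    e.isInducing.specializes_iff.symm
  have h3 : e ⟨x, hxU⟩ ⤳ e ⟨x', hxU'⟩ ↔ (e ⟨x, hxU⟩).1 ⤳ (e ⟨x', hxU'⟩).1 :=
    subtype_specializes_iff (e ⟨x, hxU⟩) (e ⟨x', hxU'⟩)
  rw [h1, h2, h3, he x hxU, he x' hxU']

/-- Over the iso-locus, `π` is injective on points. [folklore] -/
theorem eq_of_base_eq_of_isIso_morphismRestrict (x x' : X₂) (hx : π.base x ∈ U) (hx' : π.base x' ∈ U)
    (h : π.base x = π.base x') : x = x' := by
  have hxU : x ∈ π ⁻¹ᵁ U := hx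
  have hxU' : x' ∈ π ⁻¹ᵁ U := hx'
  let e := Scheme.homeoOfIso (asIso (π ∣_ U))
  have he : ∀ (z : X₂) (hz : z ∈ π ⁻¹ᵁ U), (e ⟨z, hz⟩).1 = π.base z := fun z hz => by
    change ((asIso (π ∣_ U)).hom.base ⟨z, hz⟩).1 = π.base z
    rw [asIso_hom]
    exact morphismRestrict_base_coe π U ⟨z, hz⟩
  have h1 : e ⟨x, hxU⟩ = e ⟨x', hxU'⟩ := Subtype.ext (by rw [he x hxU, he x' hxU', h])
  exact congrArg Subtype.val (e.injective h1)

/-- Over the iso-locus, every point is hit: for `y ∈ U` there is `x` with `π x = y`. [folklore] -/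
theorem exists_base_eq_of_isIso_morphismRestrict (y : X₁) (hy : y ∈ U) : ∃ x : X₂, π.base x = y := by
  let e := Scheme.homeoOfIso (asIso (π ∣_ U))
  obtain ⟨z, hz⟩ := e.surjective ⟨y, hy⟩
  refine ⟨z.1, ?_⟩
  have h := congrArg Subtype.val hz
  have he : (e z).1 = π.base z.1 := by
    change ((asIso (π ∣_ U)).hom.base z).1 = π.base z.1
    rw [asIso_hom]
    exact morphismRestrict_base_coe π U z
  rw [he] at h
  exact h

end IsoOver

/-! ## §3 The count drop under a super-strongly confined step -/

/-- **Super-strong steps make the number of maximal bad points drop.** Let `π : X₂ ⟶ X₁` be an isomorphism over the open `U` with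
underlying set `(closure {η})ᶜ`; let `Bad₁`, `Bad₂` be predicates on the points of `X₁`, `X₂` with `Bad₂ x ↔ Bad₁ (π x)` for `x` over `U`,
and suppose NO point of `X₂` over `closure {η}` satisfies `Bad₂`.  If `η` is a generization-maximal `Bad₁`-point and the generization-maximal
`Bad₁`-points are finitely many, then the generization-maximal `Bad₂`-points of `X₂` are strictly fewer: `x ↦ π x` maps them injectively
to generization-maximal `Bad₁`-points (maximality transfers because every `Bad₁`-point generizing `π x` lies off `closure {η}`, hence under
`U`, where `π` is a specialization-preserving bijection) and misses `η`. [folklore] -/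
theorem card_maximal_lt_of_superStrongStep {X₂ X₁ : Scheme.{0}} (π : X₂ ⟶ X₁) (η : X₁) (U : X₁.Opens)
    (hU : (U : Set X₁) = (closure ({η} : Set X₁))ᶜ) [IsIso (π ∣_ U)] (Bad₁ : X₁ → Prop) (Bad₂ : X₂ → Prop)
    (htrans : ∀ x : X₂, π.base x ∈ U → (Bad₂ x ↔ Bad₁ (π.base x)))
    (hgood : ∀ x : X₂, π.base x ∈ closure ({η} : Set X₁) → ¬ Bad₂ x)
    (hη : Bad₁ η ∧ ∀ y : X₁, Bad₁ y → y ⤳ η → y = η)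
    (hfin : {ξ : X₁ | Bad₁ ξ ∧ ∀ y : X₁, Bad₁ y → y ⤳ ξ → y = ξ}.Finite) :
    Nat.card {ξ : X₂ // Bad₂ ξ ∧ ∀ y : X₂, Bad₂ y → y ⤳ ξ → y = ξ} <
      Nat.card {ξ : X₁ // Bad₁ ξ ∧ ∀ y : X₁, Bad₁ y → y ⤳ ξ → y = ξ} := by
  classical
  -- a bad point of `X₂` lies over `U`
  have hoverU : ∀ x : X₂, Bad₂ x → π.base x ∈ U := fun x hx => by
    rw [← SetLike.mem_coe, hU, Set.mem_compl_iff]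
    exact fun h => hgood x h hx
  -- a `Bad₁`-point generizing a point off `closure {η}` lies over `U`
  have hgenU : ∀ (y y' : X₁), y ⤳ y' → y' ∈ U → y ∈ U := fun y y' hsp hy' => by
    rw [← SetLike.mem_coe, hU, Set.mem_compl_iff] at hy' ⊢
    exact fun hy => hy' (isClosed_closure.closure_subset_iff.mpr (Set.singleton_subset_iff.mpr hy)
      (specializes_iff_mem_closure.mp hsp))
  -- the comparison map
  let f : {ξ : X₂ // Bad₂ ξ ∧ ∀ y : X₂, Bad₂ y → y ⤳ ξ → y = ξ} →
      {ξ : X₁ // Bad₁ ξ ∧ ∀ y : X₁, Bad₁ y → y ⤳ ξ → y = ξ} := fun x =>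
    ⟨π.base x.1, (htrans x.1 (hoverU x.1 x.2.1)).mp x.2.1, fun y hy hsp => by
      have hyU : y ∈ U := hgenU y _ hsp (hoverU x.1 x.2.1)
      obtain ⟨x', hx'⟩ := exists_base_eq_of_isIso_morphismRestrict π U y hyU
      have hx'U : π.base x' ∈ U := hx' ▸ hyU
      have hbad' : Bad₂ x' := (htrans x' hx'U).mpr (hx' ▸ hy)
      have hsp' : x' ⤳ x.1 :=
        (specializes_iff_of_isIso_morphismRestrict π U x' x.1 hx'U (hoverU x.1 x.2.1)).mpr (hx' ▸ hsp)
      rw [← hx', x.2.2 x' hbad' hsp']⟩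
  have hfinj : Function.Injective f := by
    intro x x' h
    have h' : π.base x.1 = π.base x'.1 := congrArg Subtype.val h
    exact Subtype.ext (eq_of_base_eq_of_isIso_morphismRestrict π U x.1 x'.1 (hoverU x.1 x.2.1) (hoverU x'.1 x'.2.1) h')
  have hηnot : (⟨η, hη⟩ : {ξ : X₁ // Bad₁ ξ ∧ ∀ y : X₁, Bad₁ y → y ⤳ ξ → y = ξ}) ∉ Set.range f := by
    rintro ⟨x, hx⟩
    have h' : π.base x.1 = η := congrArg Subtype.val hx
    have hU' := hoverU x.1 x.2.1
    rw [h', ← SetLike.mem_coe, hU, Set.mem_compl_iff] at hU'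
    exact hU' (subset_closure (Set.mem_singleton η))
  haveI : Finite {ξ : X₁ // Bad₁ ξ ∧ ∀ y : X₁, Bad₁ y → y ⤳ ξ → y = ξ} := hfin.to_subtype
  haveI : Finite {ξ : X₂ // Bad₂ ξ ∧ ∀ y : X₂, Bad₂ y → y ⤳ ξ → y = ξ} := Finite.of_injective f hfinj
  haveI := Fintype.ofFinite {ξ : X₁ // Bad₁ ξ ∧ ∀ y : X₁, Bad₁ y → y ⤳ ξ → y = ξ}
  haveI := Fintype.ofFinite {ξ : X₂ // Bad₂ ξ ∧ ∀ y : X₂, Bad₂ y → y ⤳ ξ → y = ξ}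
  rw [Nat.card_eq_fintype_card, Nat.card_eq_fintype_card]
  exact Fintype.card_lt_of_injective_of_notMem f hfinj hηnot

/-! ## §4 (appended) The count drop under a STRONG⁺ step: only the NON-CLOSED maximal bad points are counted -/

/-- Over the iso-locus, the fibre of `π` over `π x` is `{x}`; hence `x` is closed if `π x` is. [folklore] -/
theorem isClosed_singleton_of_isClosed_base {X₂ X₁ : Scheme.{0}} (π : X₂ ⟶ X₁) (U : X₁.Opens) [IsIso (π ∣_ U)]
    (x : X₂) (hx : π.base x ∈ U) (hc : IsClosed ({π.base x} : Set X₁)) : IsClosed ({x} : Set X₂) := by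
  have hfib : π.base ⁻¹' {π.base x} = {x} := by
    ext x'
    simp only [Set.mem_preimage, Set.mem_singleton_iff]
    constructor
    · intro h
      exact eq_of_base_eq_of_isIso_morphismRestrict π U x' x (h ▸ hx) hx h
    · rintro rfl; rfl
  rw [← hfib]
  exact hc.preimage π.continuous

/-- **STRONG⁺ steps make the number of maximal NON-CLOSED bad points drop** (CRUX-PLAN hole-#3 interfaces v3, R3′ shape). As
`card_maximal_lt_of_superStrongStep`, but the step is only required to leave no NON-CLOSED `Bad₂`-point over `closure {η}` (new CLOSED
bad points over the component are allowed — they are hole #4's), and accordingly only the non-closed generization-maximal bad points are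
counted: `x ↦ π x` maps those of `X₂` injectively to those of `X₁` (a point over the iso-locus is closed iff its image is,
`isClosed_singleton_of_isClosed_base`) and misses `η`. Finiteness is asked of ALL generization-maximal `Bad₁`-points (as delivered by
`finite_setOf_maximal_of_isClosed`). [folklore] -/
theorem card_maximal_nonclosed_lt_of_strongPlusStep {X₂ X₁ : Scheme.{0}} (π : X₂ ⟶ X₁) (η : X₁) (U : X₁.Opens)
    (hU : (U : Set X₁) = (closure ({η} : Set X₁))ᶜ) [IsIso (π ∣_ U)] (Bad₁ : X₁ → Prop) (Bad₂ : X₂ → Prop)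
    (htrans : ∀ x : X₂, π.base x ∈ U → (Bad₂ x ↔ Bad₁ (π.base x)))
    (hgood : ∀ x : X₂, π.base x ∈ closure ({η} : Set X₁) → ¬ IsClosed ({x} : Set X₂) → ¬ Bad₂ x)
    (hη : ¬ IsClosed ({η} : Set X₁) ∧ Bad₁ η ∧ ∀ y : X₁, Bad₁ y → y ⤳ η → y = η)
    (hfin : {ξ : X₁ | Bad₁ ξ ∧ ∀ y : X₁, Bad₁ y → y ⤳ ξ → y = ξ}.Finite) :
    Nat.card {ξ : X₂ // ¬ IsClosed ({ξ} : Set X₂) ∧ Bad₂ ξ ∧ ∀ y : X₂, Bad₂ y → y ⤳ ξ → y = ξ} <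
      Nat.card {ξ : X₁ // ¬ IsClosed ({ξ} : Set X₁) ∧ Bad₁ ξ ∧ ∀ y : X₁, Bad₁ y → y ⤳ ξ → y = ξ} := by
  classical
  -- a non-closed bad point of `X₂` lies over `U`
  have hoverU : ∀ x : X₂, ¬ IsClosed ({x} : Set X₂) → Bad₂ x → π.base x ∈ U := fun x hxc hx => by
    rw [← SetLike.mem_coe, hU, Set.mem_compl_iff]
    exact fun h => hgood x h hxc hx
  -- a `Bad₁`-point generizing a point off `closure {η}` lies over `U`
  have hgenU : ∀ (y y' : X₁), y ⤳ y' → y' ∈ U → y ∈ U := fun y y' hsp hy' => by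
    rw [← SetLike.mem_coe, hU, Set.mem_compl_iff] at hy' ⊢
    exact fun hy => hy' (isClosed_closure.closure_subset_iff.mpr (Set.singleton_subset_iff.mpr hy)
      (specializes_iff_mem_closure.mp hsp))
  -- a bad point of `X₂` over `U` which specializes to nothing bad over `closure {η}`… the comparison map
  let f : {ξ : X₂ // ¬ IsClosed ({ξ} : Set X₂) ∧ Bad₂ ξ ∧ ∀ y : X₂, Bad₂ y → y ⤳ ξ → y = ξ} →
      {ξ : X₁ // ¬ IsClosed ({ξ} : Set X₁) ∧ Bad₁ ξ ∧ ∀ y : X₁, Bad₁ y → y ⤳ ξ → y = ξ} := fun x =>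
    ⟨π.base x.1,
      fun hc => x.2.1 (isClosed_singleton_of_isClosed_base π U x.1 (hoverU x.1 x.2.1 x.2.2.1) hc),
      (htrans x.1 (hoverU x.1 x.2.1 x.2.2.1)).mp x.2.2.1, fun y hy hsp => by
      have hxU := hoverU x.1 x.2.1 x.2.2.1
      have hyU : y ∈ U := hgenU y _ hsp hxU
      obtain ⟨x', hx'⟩ := exists_base_eq_of_isIso_morphismRestrict π U y hyU
      have hx'U : π.base x' ∈ U := hx' ▸ hyU
      have hbad' : Bad₂ x' := (htrans x' hx'U).mpr (hx' ▸ hy)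
      have hsp' : x' ⤳ x.1 := (specializes_iff_of_isIso_morphismRestrict π U x' x.1 hx'U hxU).mpr (hx' ▸ hsp)
      rw [← hx', x.2.2.2 x' hbad' hsp']⟩
  have hfinj : Function.Injective f := by
    intro x x' h
    have h' : π.base x.1 = π.base x'.1 := congrArg Subtype.val h
    exact Subtype.ext (eq_of_base_eq_of_isIso_morphismRestrict π U x.1 x'.1 (hoverU x.1 x.2.1 x.2.2.1)
      (hoverU x'.1 x'.2.1 x'.2.2.1) h')
  have hηnot : (⟨η, hη⟩ : {ξ : X₁ // ¬ IsClosed ({ξ} : Set X₁) ∧ Bad₁ ξ ∧ ∀ y : X₁, Bad₁ y → y ⤳ ξ → y = ξ}) ∉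
      Set.range f := by
    rintro ⟨x, hx⟩
    have h' : π.base x.1 = η := congrArg Subtype.val hx
    have hU' := hoverU x.1 x.2.1 x.2.2.1
    rw [h', ← SetLike.mem_coe, hU, Set.mem_compl_iff] at hU'
    exact hU' (subset_closure (Set.mem_singleton η))
  have hfin' : {ξ : X₁ | ¬ IsClosed ({ξ} : Set X₁) ∧ Bad₁ ξ ∧ ∀ y : X₁, Bad₁ y → y ⤳ ξ → y = ξ}.Finite :=
    hfin.subset fun ξ hξ => hξ.2
  haveI : Finite {ξ : X₁ // ¬ IsClosed ({ξ} : Set X₁) ∧ Bad₁ ξ ∧ ∀ y : X₁, Bad₁ y → y ⤳ ξ → y = ξ} := hfin'.to_subtype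
  haveI : Finite {ξ : X₂ // ¬ IsClosed ({ξ} : Set X₂) ∧ Bad₂ ξ ∧ ∀ y : X₂, Bad₂ y → y ⤳ ξ → y = ξ} :=
    Finite.of_injective f hfinj
  haveI := Fintype.ofFinite {ξ : X₁ // ¬ IsClosed ({ξ} : Set X₁) ∧ Bad₁ ξ ∧ ∀ y : X₁, Bad₁ y → y ⤳ ξ → y = ξ}
  haveI := Fintype.ofFinite {ξ : X₂ // ¬ IsClosed ({ξ} : Set X₂) ∧ Bad₂ ξ ∧ ∀ y : X₂, Bad₂ y → y ⤳ ξ → y = ξ}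
  rw [Nat.card_eq_fintype_card, Nat.card_eq_fintype_card]
  exact Fintype.card_lt_of_injective_of_notMem f hfinj hηnot

end Summit.ResolutionOfSingularities.ResolutionOfSingularities.Theorems.FInjectiveMacaulayfication.BadMaximalPoints

end
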